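import Summits.QuantumFields.BalabanUV.Beta.HessKerDressedUnitsWall
import Summits.QuantumFields.BalabanUV.Beta.FixedPointIdentification

/-!
# `BalabanUV.Beta.FP.RoadEnd` — road «FP» (fixed-point uniqueness) for binder row D1: THE END BY TYPE.  The wall literal
# `OneStepKernelFamily.D1Drift Lc (JsBalOf …) N μ ν` from road A2's (CONV-C-Cauchy) data in limit currency (asym1, BY NAME) + the STEP LAW
# and the LEADING-LOG ASYMPTOTICS of the perfect (fixed-point) coefficient family `g m` (`g 1` = the second moment of the limit kernel)

HONEST FRAMING (cell contract, verbatim): «discharging `BetaPertH` makes Bałaban's UV stability UNCONDITIONAL — a real constructive-QFT result;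
it is NOT the continuum limit and NOT the Clay problem.»  THIS MODULE DISCHARGES NOTHING of the wall: every analytic input is a HYPOTHESIS
(the nine limit-currency (CONV-C-Cauchy) binders of asym1's `HessKerDressedUnitsWall.d1Drift_JsBalOf_of_lim_eq_unit` = binder row G-an2-4; the step
law (STEP) and the asymptotics (ASYMP) of road FP = leaves N2/N6 and N7 of `HOME/beta/skeletons/D1-b2b-balaban-beta-d1-p3.md`).  What is KERNEL here is
the COMPOSITION: under those hypotheses the wall literal follows, the identification `hident` (O-asym1-7) being FORCED by
`FixedPointIdentification` (no fixed-`Lc` sum evaluated).  NOT BetaPertH, NOT continuum, NOT Clay.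
ABSOLUTE RULE (cell, verbatim): «No internally-minted statement may enter as a cited fact. Every hypothesis is either kernel-proved in this package or a
verbatim quotation of a PUBLISHED theorem with page reference.»  Nothing is cited; no `def`; no binder is instantiated at a value.

CONTENT.
* §1 the `m`-indexed value lemmas (the perfect family is naturally indexed by the number `m` of steps, blocking `Lc^m`): `pow_law_of_step_law'`
  (`g (m+1) = g m + g 1` ⇒ `g m = m · g 1`), `value_eq_of_step_law_bounded'` / `_littleO'` (`+ |g m − m·v| ≤ C` resp. `(g m − m·v)/m → 0` ⇒ `g 1 = v`).
* §2 **`d1Drift_JsBalOf_of_rate_step_law_bounded`** / **`_littleO`** — ROAD FP's END over an2's wall family `JsBalOf` (v2.18; the v2.21 literal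
  `MixedJetTablesPlug.JsBalAn1` is an instance by unfolding `JsBalT2Of`/`JsBalW2Of`): asym1's nine limit-currency binders at ANY named limit triple
  `(Kinf, Sinf, Winf)` + a real sequence `g` with `g 1 = secondMoment (hessKer (axDressK Lc Kinf) (axVertexOfK Kinf Lc Sinf) Winf) μ ν` + (STEP) + (ASYMP)
  ⊢ `D1Drift Lc (JsBalOf …) N μ ν`.  (Rooted / co-dressed / Π_bm literals: replace the last line by `HessKerRootedWall.d1Drift_JsBalAn1At_of_cauchy_eq_unit`
  &c. — same `hident`, not restated here.)
-/

namespace Summit.QuantumFields.BalabanUV.Beta.FP.RoadEnd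

open Filter Topology
open Literature.MathematicalPhysics.QuantumFieldTheory.Balaban1983to89
open Literature.MathematicalPhysics.QuantumFieldTheory.Balaban1983to89.Beta
open ExpKernelCalculus (MKer Decays VertexFamily₂ hessKer)
open OneStepResolventKernel (Fib LocStencil)
open OneStepKernelFamily (KInvStep D1Drift)
open AxialDressing (axDressK axVertexOfK)
open BalabanStepJetsSucc (JsBal0Of JsBalOf)
open B12Normalization (stepBal)
open Summit.QuantumFields.BalabanUV.Beta.HessKerDressedUnits (unitK unitS unitW)
open Summit.QuantumFields.BalabanUV.Beta.HessKerDressedUnitsWall (d1Drift_JsBalOf_of_lim_eq_unit)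
open Summit.QuantumFields.BalabanUV.Beta.FixedPointIdentification (eq_of_nat_mul_sub_bounded)

/-! ## §1 The `m`-indexed value lemmas -/

/-- [our object] STEP LAW ⇒ POWER LAW, `m`-indexed: `g (m+1) = g m + g 1` for `m ≥ 1` gives `g m = m · g 1` for `m ≥ 1`. -/
theorem pow_law_of_step_law' {g : ℕ → ℝ} (hstep : ∀ m : ℕ, 1 ≤ m → g (m + 1) = g m + g 1) :
    ∀ m : ℕ, 1 ≤ m → g m = (m : ℝ) * g 1 := by
  intro m hm
  induction m with
  | zero => exact absurd hm (by norm_num)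
  | succ n ih =>
    rcases Nat.eq_zero_or_pos n with h0 | hpos
    · subst h0; simp
    · rw [hstep n hpos, ih hpos]; push_cast; ring

/-- [our object] POWER LAW + BOUNDED DEFECT ⇒ VALUE, `m`-indexed: `g m = m·g 1` and `|g m − m·v| ≤ C` for `m ≥ 1` give `g 1 = v`. -/
theorem value_eq_of_step_law_bounded' {g : ℕ → ℝ} {v C : ℝ} (hstep : ∀ m : ℕ, 1 ≤ m → g (m + 1) = g m + g 1)
    (hasym : ∀ m : ℕ, 1 ≤ m → |g m - (m : ℝ) * v| ≤ C) : g 1 = v := by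
  have hpow := pow_law_of_step_law' hstep
  refine eq_of_nat_mul_sub_bounded (C := max C 0) fun m => ?_
  rcases Nat.eq_zero_or_pos m with h0 | hpos
  · subst h0; simp
  · have := hasym m hpos
    rw [hpow m hpos] at this
    rw [mul_sub]
    exact this.trans (le_max_left _ _)

/-- [our object] POWER LAW + `o(m)` DEFECT ⇒ VALUE, `m`-indexed (mean-law form). -/
theorem value_eq_of_step_law_littleO' {g : ℕ → ℝ} {v : ℝ} (hstep : ∀ m : ℕ, 1 ≤ m → g (m + 1) = g m + g 1)
    (hasym : Tendsto (fun m : ℕ => (g m - (m : ℝ) * v) / (m : ℝ)) atTop (𝓝 0)) : g 1 = v := by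
  have hpow := pow_law_of_step_law' hstep
  have hev : (fun m : ℕ => (g m - (m : ℝ) * v) / (m : ℝ)) =ᶠ[atTop] fun _ => g 1 - v := by
    filter_upwards [eventually_ge_atTop 1] with m hm
    have hm' : (m : ℝ) ≠ 0 := by exact_mod_cast (Nat.one_le_iff_ne_zero.mp hm)
    rw [hpow m hm, ← mul_sub, mul_div_cancel_left₀ _ hm']
  have hconst : Tendsto (fun _ : ℕ => g 1 - v) atTop (𝓝 0) := hasym.congr' hev
  have := tendsto_const_nhds_iff.mp hconst
  linarith

/-! ## §2 ROAD FP's END over the wall family, BY TYPE -/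

section End

variable {Lc : ℕ} [NeZero Lc] (hLc : 1 ≤ Lc) (cE cVH cΛ : ℝ)
  (W : ℕ → Fin (3 + 1) → (Fin (3 + 1) → ℤ) → Fin (3 + 1) → (Fin (3 + 1) → ℤ) → MKer (3 + 1) (Fib 3))
  (Cw' δw : ℕ → ℝ) (hδw : ∀ j, 0 < δw j) (hW' : ∀ j, VertexFamily₂ (W j) Lc (Cw' j) (δw j))
  (sf sm : ℕ → ℝ)
  {Kinf : MKer (3 + 1) (Fib 3)} {Sinf : Fin (3 + 1) → (Fin (3 + 1) → ℤ) → MKer (3 + 1) (Fib 3)}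
  {Winf : Fin (3 + 1) → (Fin (3 + 1) → ℤ) → Fin (3 + 1) → (Fin (3 + 1) → ℤ) → MKer (3 + 1) (Fib 3)}
  {R C cK δK Cs cS δS Cw cW δW θ : ℝ}

/-- **ROAD «FP», THE END BY TYPE (bounded-defect form).**  For an2's wall family `JsBalOf …` and ANY named limit triple `(Kinf, Sinf, Winf)`: IF the nine
limit-currency (CONV-C-Cauchy) binders of road A2 hold (row G-an2-4 — HYPOTHESES), AND a real sequence `g` (READING: `g m` = the (1.22)-type coefficient of
the perfect `m`-fold step, `g 1` = that of the perfect `Lc`-step = the second moment of the limit kernel) satisfies `hg1`, the STEP LAW `g (m+1) = g m + g 1`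
(scale invariance of the fixed point — leaf N2/N6) and the LEADING-LOG ASYMPTOTICS `|g m − m · stepBal N Lc| ≤ C` (leaf N7), THEN the wall literal
`D1Drift Lc (JsBalOf …) N μ ν` holds.  The identification `hident` of asym1's `d1Drift_JsBalOf_of_lim_eq_unit` is DERIVED inside (`value_eq_of_step_law_bounded'`),
never assumed and never computed.  Discharges nothing by itself. -/
theorem d1Drift_JsBalOf_of_rate_step_law_bounded (hsf : ∀ j, sf j ≠ 0) (hsm : ∀ j, sm j ≠ 0)
    (hK : ∀ j, Decays (unitK (sf j) (sm j) (KInvStep (d := 3) Lc j)) C δK) (hKinf : Decays Kinf C δK)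
    (hKrate : ∀ j, Decays (unitK (sf j) (sm j) (KInvStep (d := 3) Lc j) - Kinf) (cK * θ ^ j) δK)
    (hS : ∀ j, LocStencil (unitS (sf j) (sm j) (JsBal0Of hLc cE cVH cΛ W Cw' δw hδw hW' j).S) Cs δS) (hSinf : LocStencil Sinf Cs δS)
    (hSrate : ∀ j, LocStencil (unitS (sf j) (sm j) (JsBal0Of hLc cE cVH cΛ W Cw' δw hδw hW' j).S - Sinf) (cS * θ ^ j) δS)
    (hW : ∀ j, VertexFamily₂ (unitW (sf j) (sm j) (W j)) Lc Cw δW) (hWinf : VertexFamily₂ Winf Lc Cw δW)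
    (hWrate : ∀ j, VertexFamily₂ (unitW (sf j) (sm j) (W j) - Winf) Lc (cW * θ ^ j) δW)
    (hR : 0 < R) (hRK : R < δK) (hRS : R / 2 < δS) (hRW : R < δW) (hθ0 : 0 ≤ θ) (hθ1 : θ < 1) (μ ν : Fin 4) {N : ℝ}
    {g : ℕ → ℝ} {Cg : ℝ} (hg1 : g 1 = B12Beta.secondMoment (hessKer (axDressK Lc Kinf) (axVertexOfK Kinf Lc Sinf) Winf) μ ν)
    (hstep : ∀ m : ℕ, 1 ≤ m → g (m + 1) = g m + g 1)
    (hasym : ∀ m : ℕ, 1 ≤ m → |g m - (m : ℝ) * stepBal N Lc| ≤ Cg) :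
    D1Drift Lc (JsBalOf hLc cE cVH cΛ W Cw' δw hδw hW') N μ ν :=
  d1Drift_JsBalOf_of_lim_eq_unit hLc cE cVH cΛ W Cw' δw hδw hW' sf sm hsf hsm hK hKinf hKrate hS hSinf hSrate hW hWinf hWrate
    hR hRK hRS hRW hθ0 hθ1 μ ν (hg1 ▸ value_eq_of_step_law_bounded' hstep hasym)

/-- **ROAD «FP», THE END BY TYPE (mean-law form)**: as above with the asymptotic input weakened to `(g m − m · stepBal N Lc)/m → 0`. -/
theorem d1Drift_JsBalOf_of_rate_step_law_littleO (hsf : ∀ j, sf j ≠ 0) (hsm : ∀ j, sm j ≠ 0)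
    (hK : ∀ j, Decays (unitK (sf j) (sm j) (KInvStep (d := 3) Lc j)) C δK) (hKinf : Decays Kinf C δK)
    (hKrate : ∀ j, Decays (unitK (sf j) (sm j) (KInvStep (d := 3) Lc j) - Kinf) (cK * θ ^ j) δK)
    (hS : ∀ j, LocStencil (unitS (sf j) (sm j) (JsBal0Of hLc cE cVH cΛ W Cw' δw hδw hW' j).S) Cs δS) (hSinf : LocStencil Sinf Cs δS)
    (hSrate : ∀ j, LocStencil (unitS (sf j) (sm j) (JsBal0Of hLc cE cVH cΛ W Cw' δw hδw hW' j).S - Sinf) (cS * θ ^ j) δS)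
    (hW : ∀ j, VertexFamily₂ (unitW (sf j) (sm j) (W j)) Lc Cw δW) (hWinf : VertexFamily₂ Winf Lc Cw δW)
    (hWrate : ∀ j, VertexFamily₂ (unitW (sf j) (sm j) (W j) - Winf) Lc (cW * θ ^ j) δW)
    (hR : 0 < R) (hRK : R < δK) (hRS : R / 2 < δS) (hRW : R < δW) (hθ0 : 0 ≤ θ) (hθ1 : θ < 1) (μ ν : Fin 4) {N : ℝ}
    {g : ℕ → ℝ} (hg1 : g 1 = B12Beta.secondMoment (hessKer (axDressK Lc Kinf) (axVertexOfK Kinf Lc Sinf) Winf) μ ν)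
    (hstep : ∀ m : ℕ, 1 ≤ m → g (m + 1) = g m + g 1)
    (hasym : Tendsto (fun m : ℕ => (g m - (m : ℝ) * stepBal N Lc) / (m : ℝ)) atTop (𝓝 0)) :
    D1Drift Lc (JsBalOf hLc cE cVH cΛ W Cw' δw hδw hW') N μ ν :=
  d1Drift_JsBalOf_of_lim_eq_unit hLc cE cVH cΛ W Cw' δw hδw hW' sf sm hsf hsm hK hKinf hKrate hS hSinf hSrate hW hWinf hWrate
    hR hRK hRS hRW hθ0 hθ1 μ ν (hg1 ▸ value_eq_of_step_law_littleO' hstep hasym)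

end End

end Summit.QuantumFields.BalabanUV.Beta.FP.RoadEnd
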